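import Summits.QuantumFields.GaugeBoot.DiagonalRPTorusHalfAction
import Summits.QuantumFields.GaugeBoot.DiagonalRPTorusTubeGeometry
import HarnessLib

/-!
# Layers of the torus `(ℤ/L)^d` relative to the mirror `y_i = y_j` (gauge-boot, L3 sequel, 5/9)

HONEST FRAMING (cell `pub-gaugeboot`, page 1 of every file): the venture produces certified bounds
on lattice expectations at stated coupling, gauge group, dimension and torus size; NOT a mass gap,
NOT a continuum limit, NOT a string tension; NOT Yang–Mills-summit-bearing (barriers
`FixedCouplingUltralocality`, `PerturbativeInvisibility`). This module is bookkeeping for a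
structural NEGATIVE result (`DiagonalRPTorusInnerHalfNegativeHighDim`); it discharges nothing by
itself.

## Content (torus `(ℤ/L)^d`, `L = 2c`, `c ≥ 2`, mirror `y_i = y_j`, `i < j < k < l`)

With `δ(y) = y_i - y_j` (`lay`), the inner half is `δ.val < c` (`h = c = L/2`), its mirror image
is `(-δ).val < c`, and the BACK LAYER is `δ = c = -c`. For the plaquette sets of
`DiagonalRPTorusHalfAction` (`innerPlaqs`, `swapPlaqs`, `restPlaqs`):

* layer arithmetic `lay_shift` / `lay_dn` and the membership tests
  `not_mem_restPlaqs_of_layers` (all vertices at natural layers `< c` ⇒ inner ⇒ not in the rest),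
  `not_mem_restPlaqs_of_neg_layers` (all at layers `-t`, `t < c` ⇒ mirror image of inner),
* `mem_restPlaqs_of_vert` (a vertex `δ` with neither `δ` nor `-δ` in the half ⇒ in the rest);
  the cover lemmas built on these are in `DiagonalRPTorusTubeRings`.

Elementary bookkeeping; no named fact.
-/

open Finset Function

namespace Summit.QuantumFields.GaugeBoot

open Literature.MathematicalPhysics.QuantumFieldTheory

namespace DiagRPTube

variable {d L : ℕ}

/-! ## Layer arithmetic -/

section Lay

variable {i j : Fin d}

/-- `δ(y + e_m) = δ(y) + [m = i] - [m = j]`. -/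
theorem lay_shift (y : Site d L) (m : Fin d) :
    lay i j (y.shift m) = lay i j y + (if m = i then 1 else 0) - (if m = j then 1 else 0) := by
  simp only [lay, Site.shift, Pi.add_apply, Pi.single_apply, @eq_comm _ i m, @eq_comm _ j m]
  split_ifs <;> ring

variable (hij : i ≠ j)
include hij

/-- `δ(y + e_i) = δ(y) + 1`. -/
theorem lay_shift_i (y : Site d L) : lay i j (y.shift i) = lay i j y + 1 := by
  rw [lay_shift]; simp [hij]

/-- `δ(y + e_j) = δ(y) - 1`. -/
theorem lay_shift_j (y : Site d L) : lay i j (y.shift j) = lay i j y - 1 := by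
  rw [lay_shift]; simp [Ne.symm hij]

omit hij in
/-- `δ(y + e_m) = δ(y)` for transverse `m`. -/
theorem lay_shift_of_ne (y : Site d L) {m : Fin d} (hmi : m ≠ i) (hmj : m ≠ j) :
    lay i j (y.shift m) = lay i j y := by
  rw [lay_shift]; simp [hmi, hmj]

/-- `δ(y - e_i) = δ(y) - 1`. -/
theorem lay_dn_i (y : Site d L) : lay i j (dn y i) = lay i j y - 1 := by
  have h := lay_shift_i (L := L) hij (dn y i)
  rw [dn_shift] at h
  rw [h]; ring

/-- `δ(y - e_j) = δ(y) + 1`. -/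
theorem lay_dn_j (y : Site d L) : lay i j (dn y j) = lay i j y + 1 := by
  have h := lay_shift_j (L := L) hij (dn y j)
  rw [dn_shift] at h
  rw [h]; ring

omit hij in
/-- `δ(y - e_m) = δ(y)` for transverse `m`. -/
theorem lay_dn_of_ne (y : Site d L) {m : Fin d} (hmi : m ≠ i) (hmj : m ≠ j) :
    lay i j (dn y m) = lay i j y := by
  have h := lay_shift_of_ne (L := L) (i := i) (j := j) (dn y m) hmi hmj
  rw [dn_shift] at h
  exact h.symm

omit hij in
/-- The start points of the edges of a transverse square lie on the layer of its base. -/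
theorem lay_eStart {k l : Fin d} (hki : k ≠ i) (hkj : k ≠ j) (hli : l ≠ i) (hlj : l ≠ j)
    (x : Site d L) (a : Fin 4) : lay i j (eStart k l x a) = lay i j x := by
  fin_cases a
  · rfl
  · exact lay_shift_of_ne x hki hkj
  · exact lay_shift_of_ne x hli hlj
  · rfl

end Lay

/-! ## Casts and values in `ℤ/(2c)` -/

section Casts

variable {c : ℕ}

/-- `((t : ℕ) : ℤ/L).val = t` for `t < L`. -/
theorem val_cast {t : ℕ} (ht : t < L) : ((t : ℕ) : ZMod L).val = t := by
  rw [ZMod.val_natCast, Nat.mod_eq_of_lt ht]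

/-- A natural layer `t < c` is in the half. -/
theorem val_cast_lt (hL : L = 2 * c) {t : ℕ} (ht : t < c) : ((t : ℕ) : ZMod L).val < c := by
  rw [val_cast (by omega)]; exact ht

/-- The layer `c - 1` is not the mirror. -/
theorem cast_pred_ne_zero (hc : 2 ≤ c) (hL : L = 2 * c) : ((c - 1 : ℕ) : ZMod L) ≠ 0 := by
  intro h
  have := congrArg ZMod.val h
  rw [val_cast (by omega), ZMod.val_zero] at this
  omega

/-- `-c = c` in `ℤ/(2c)`. -/
theorem neg_cast_c (hL : L = 2 * c) : -((c : ℕ) : ZMod L) = (c : ℕ) := by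
  have h : ((2 * c : ℕ) : ZMod L) = 0 := by rw [← hL]; exact ZMod.natCast_self L
  push_cast at h
  linear_combination -h

/-- The back layer is not in the half. -/
theorem not_val_c_lt (hc : 2 ≤ c) (hL : L = 2 * c) : ¬ ((c : ℕ) : ZMod L).val < c := by
  rw [val_cast (by omega)]; exact lt_irrefl c

/-- `(c-1) + 1 = c`. -/
theorem cast_pred_add_one (hc : 2 ≤ c) : ((c - 1 : ℕ) : ZMod L) + 1 = (c : ℕ) := by
  rw [← Nat.cast_add_one, Nat.sub_add_cancel (by omega)]

/-- `(c-2) + 1 = c - 1`. -/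
theorem cast_pred_pred_add_one (hc : 2 ≤ c) : ((c - 2 : ℕ) : ZMod L) + 1 = ((c - 1 : ℕ) : ZMod L) := by
  rw [← Nat.cast_add_one]
  congr 1
  omega

end Casts

/-! ## Membership tests for the rest -/

section Rest

variable {i j : Fin d} {h : ℕ} [NeZero L]

/-- All vertices at natural layers `< h` and the base off the mirror: `q` is inner, not in the
rest. -/
theorem not_mem_restPlaqs_of_layers {q : Plaquette d L}
    (hv : ∀ a : Fin 4, (lay i j (vert q a)).val < h) (h0 : ∃ a, lay i j (vert q a) ≠ 0) :
    q ∉ restPlaqs i j h := by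
  obtain ⟨a, ha⟩ := h0
  exact fun hq => (mem_restPlaqs.1 hq).1 (mem_innerPlaqs.2 ⟨hv, fun hm => ha (hm a)⟩)

/-- All vertices at layers whose negatives are `< h` and the base off the mirror: `q` is the
mirror image of an inner plaquette, not in the rest. -/
theorem not_mem_restPlaqs_of_neg_layers {q : Plaquette d L}
    (hv : ∀ a : Fin 4, (-lay i j (vert q a)).val < h) (h0 : ∃ a, lay i j (vert q a) ≠ 0) :
    q ∉ restPlaqs i j h := by
  obtain ⟨a₀, ha₀⟩ := h0
  refine fun hq => (mem_restPlaqs.1 hq).2 (mem_swapPlaqs.2 (mem_innerPlaqs.2 ⟨fun a => ?_, fun hm => ?_⟩))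
  · obtain ⟨b, hb⟩ := exists_vert_plaqSwap i j q a
    show (lay i j (vert (plaqSwap i j q) a)).val < h
    rw [hb, lay_siteDiagSwap]
    exact hv b
  · obtain ⟨b, hb⟩ := exists_vert_plaqSwap i j (plaqSwap i j q) a₀
    rw [plaqSwap_plaqSwap] at hb
    apply ha₀
    rw [hb, lay_siteDiagSwap, hm b, neg_zero]

/-- **A vertex on a layer `δ` with neither `δ` nor `-δ` in the half puts `q` in the rest.** -/
theorem mem_restPlaqs_of_vert {q : Plaquette d L} (a : Fin 4)
    (h1 : ¬ (lay i j (vert q a)).val < h) (h2 : ¬ (-lay i j (vert q a)).val < h) :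
    q ∈ restPlaqs i j h := by
  rw [mem_restPlaqs, mem_innerPlaqs, mem_swapPlaqs, mem_innerPlaqs, not_and, not_and]
  refine ⟨fun hin _ => h1 (hin a), fun hin _ => h2 ?_⟩
  obtain ⟨b, hb⟩ := exists_vert_plaqSwap i j (plaqSwap i j q) a
  rw [plaqSwap_plaqSwap] at hb
  have e : lay i j (vert (plaqSwap i j q) b) = -lay i j (vert q a) := by
    rw [hb, lay_siteDiagSwap, neg_neg]
  have := hin b
  unfold InHalf at this
  rwa [e] at this

end Rest

end DiagRPTube

end Summit.QuantumFields.GaugeBoot
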